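import Literature.NumberTheory.LFunctions.ConreyIwaniec2002Prop81MeanSquaresFloor
import Literature.NumberTheory.LFunctions.ConreyIwaniec2002Prop81LargeCloseOf
import Literature.NumberTheory.LFunctions.ConreyIwaniec2002AFEResidualBound
import Literature.NumberTheory.LFunctions.DivisorSquareWeightedSum
import Literature.NumberTheory.LFunctions.ConreyIwaniec2002PrincipalEstimateClose
import HarnessLib

/-!
# Conrey–Iwaniec (2002), Propositions 8.1 and 9.1 with CLOSE companions ABOVE THE FLOOR `q^{65}`

B. Conrey, H. Iwaniec, *Spacing of zeros of Hecke L-functions and the class number problem*,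
Acta Arith. 103 (2002), §§8–9 [held text `paper:arxiv-math_0111012`, p0018–p0020].

The tree derives Proposition 8.1 (8.10) and Proposition 9.1 (9.7) for close companions
(`|t′ − t| ≤ 1`) from Proposition 6.4 (binder `h64`) in the range `T ≥ q^{66}`, `T ≥ e^{(log q)²}`
(`prop81_large_close_of_meanSquares`, `prop91_close_of`). THIS FILE does the same at every level
`T ≥ q^{65}` for `1`-spaced `S ⊂ (T, 2T]` whose points lie above `q^{65} + q`, from the floor mean
squares `main_meanSquares'` (`ConreyIwaniec2002Prop81MeanSquaresFloor`): the residual mean square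
at the floor (`residual_meanSquare_le'`), the pointwise composition (`defectD_le_of_meanSquares'`,
the tree's proof verbatim), the coincident-companion limit (tree `defectD_limit`), giving
`prop81_floor_close_of_proposition64`; and Proposition 9.1 (9.7) by the tree's (9.7)-algebra
(`prop91_floor_close_of`, `prop91_floor_close_of_proposition64`) — the one place where
`(log q)² ≤ log T`, i.e. `e^{(log q)²} ≤ T`, is used. Cell landau-siegel / ls-inputs, I6b (the
binder range `q^{65} ≤ T` of the I6 skeleton's S1). Everything PROVED; no definition.

«The programme SEARCHES and TYPES; no claim about Landau–Siegel zeros until a kernel theorem says so.»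

## References
* [ConreyIwaniec2002] B. Conrey, H. Iwaniec, Acta Arith. 103 (2002) 259–312, arXiv:math/0111012:
  Proposition 7.1 (7.12), (7.23), §8 (8.4)–(8.10), §9 p. 20, Proposition 9.1 (9.7).
-/

noncomputable section

open scoped NumberField
open Complex Filter Topology

namespace Literature.NumberTheory.LFunctions

namespace ConreyIwaniec2002

open NumberField

/-! ### The residual mean square at the floor -/

/-- **CI §8: `Σ_{s ∈ S} |r(s)|² ≤ C·T`** for the divided differences
`r(s) = (R(s) − R(s′))/(s − s′)` of the residual term of Proposition 7.1 over a `1`-spaced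
`S ⊂ (T, 2T]`, `T ≥ q^65`, companions `0 < |t′ − t| ≤ 1` (the tree's S6a `residual_meanSquare_le`
at the floor; `R = 0` unless `ψ = 1`).
[cite: ConreyIwaniec2002, §8 (8.4)–(8.10), Proposition 7.1 (7.12)] -/
theorem residual_meanSquare_le' :
    ∃ C : ℝ, 0 < C ∧
    ∀ (q : ℕ) [NeZero q], 4 < q →
      ∀ (K : Type) [Field K] [NumberField K],
        Module.finrank ℚ K = 2 → NumberField.discr K = -(q : ℤ) →
          ∀ (ψ : ClassGroup (𝓞 K) →* ℂˣ) (T : ℝ) (S : Finset ℝ) (t' : ℝ → ℝ),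
            (q : ℝ) ^ (65 : ℕ) ≤ T → IsDyadicPointSet S T → (∀ t ∈ S, t' t ≠ t ∧ |t' t - t| ≤ 1) →
              ∑ t ∈ S, ‖(afeR K ψ q (1 / 2 + t * I) - afeR K ψ q (1 / 2 + t' t * I)) /
                  ((t : ℂ) * I - t' t * I)‖ ^ 2 ≤ C * T := by
  classical
  obtain ⟨M, hM, hdd⟩ := norm_dividedDiff_afeR_one_le
  refine ⟨80 * M ^ 2, by positivity, ?_⟩
  intro q _ hq K _ _ h2 hdisc ψ T S t' hT hS ht'
  have hq0 : 0 < q := by omega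
  have hq5 : (5 : ℝ) ≤ q := by exact_mod_cast hq
  -- `T ≥ q^65 ≥ q + 7`
  have hT7 : (q : ℝ) + 7 ≤ T := by
    have h1 : (q : ℝ) ^ (65 : ℕ) = q * (q : ℝ) ^ (64 : ℕ) := by ring
    have h65 : (5 : ℝ) ≤ (q : ℝ) ^ (64 : ℕ) := by
      calc (5 : ℝ) ≤ q := hq5
        _ = (q : ℝ) ^ 1 := (pow_one _).symm
        _ ≤ (q : ℝ) ^ (64 : ℕ) := pow_le_pow_right₀ (by linarith) (by norm_num)
    nlinarith
  have hT2 : (2 : ℝ) ≤ T := by linarith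
  -- the cardinality of `S`
  have hcard : (S.card : ℝ) ≤ 2 * (2 * T) + 2 :=
    ZetaM4D.card_le_of_sep S (by linarith) (fun t ht => by
      obtain ⟨h1, h2⟩ := hS.1 t ht
      rw [abs_of_pos (by linarith)]; exact h2) hS.2
  -- pointwise bound
  have hpt : ∀ t ∈ S, ‖(afeR K ψ q (1 / 2 + t * I) - afeR K ψ q (1 / 2 + t' t * I)) /
      ((t : ℂ) * I - t' t * I)‖ ^ 2 ≤ (4 * M) ^ 2 := by
    intro t ht
    apply pow_le_pow_left₀ (norm_nonneg _)
    by_cases hψ : ψ = 1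
    · subst hψ
      obtain ⟨hTt, -⟩ := hS.1 t ht
      refine hdd q hq0 K h2 hdisc t (t' t) (ht' t ht).1 fun u hu => ?_
      have hu1 : t - 1 ≤ u := by
        rcases Set.mem_uIcc.mp hu with ⟨h1, -⟩ | ⟨h1, -⟩
        · have := (abs_le.mp (ht' t ht).2).1; linarith
        · linarith
      constructor <;> linarith
    · simp [afeR_of_ne_one hψ]
      positivity
  calc ∑ t ∈ S, ‖(afeR K ψ q (1 / 2 + t * I) - afeR K ψ q (1 / 2 + t' t * I)) /
        ((t : ℂ) * I - t' t * I)‖ ^ 2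
      ≤ ∑ t ∈ S, (4 * M) ^ 2 := Finset.sum_le_sum hpt
    _ = S.card * (4 * M) ^ 2 := by rw [Finset.sum_const, nsmul_eq_mul]
    _ ≤ (2 * (2 * T) + 2) * (4 * M) ^ 2 := by gcongr
    _ ≤ (5 * T) * (4 * M) ^ 2 := by gcongr; linarith
    _ = 80 * M ^ 2 * T := by ring

/-! ### Proposition 8.1 above the floor from the mean squares -/

/-- **Proposition 8.1 above the floor, for companions OFF the diagonal** from the mean squares `hS6`: the
identity, `|X| = 1` on the critical line (tree `norm_afeX_half`), `|x(s)| ≤ C₃(log q + log t)`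
(tree `norm_xQuot_le`), and S6. [cite: ConreyIwaniec2002, Proposition 8.1 (8.10)] -/
theorem defectD_le_of_meanSquares' (hS6 : ∃ C : ℝ, 0 < C ∧
    ∀ (q : ℕ) [NeZero q], 4 < q → Odd q → ∀ χ : DirichletCharacter ℂ q,
      χ.IsPrimitive → χ.IsQuadratic → χ.Odd →
        ∀ (K : Type) [Field K] [NumberField K],
          Module.finrank ℚ K = 2 → NumberField.discr K = -(q : ℤ) →
            ∀ (ψ : ClassGroup (𝓞 K) →* ℂˣ) (T : ℝ) (S : Finset ℝ) (t' : ℝ → ℝ),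
              (q : ℝ) ^ (65 : ℕ) ≤ T → IsDyadicPointSet S T → (∀ t ∈ S, (q : ℝ) ^ (65 : ℕ) + q ≤ t) →
                (∀ t ∈ S, t' t ≠ t ∧ |t' t - t| ≤ 1) →
                (∑ t ∈ S, ‖(afeA K ψ q (1 / 2 + t * I) - afeA K ψ q (1 / 2 + t' t * I)) /
                    ((t : ℂ) * I - t' t * I)‖ ^ 2 ≤
                  C * (T * Real.log q ^ (7 : ℕ) + T * calL χ T * Real.log T ^ (4 : ℕ))) ∧
                (Real.log T ^ (2 : ℕ) *
                    ∑ t ∈ S, ‖afeA K ψ q (1 / 2 + t * I) - shortLSum K ψ q (1 / 2 + t * I)‖ ^ 2 ≤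
                  C * (T * Real.log q ^ (7 : ℕ) + T * calL χ T * Real.log T ^ (4 : ℕ))) ∧
                (∑ t ∈ S, ‖(afeR K ψ q (1 / 2 + t * I) - afeR K ψ q (1 / 2 + t' t * I)) /
                    ((t : ℂ) * I - t' t * I)‖ ^ 2 ≤ C * T)) :
    ∃ C : ℝ, 0 < C ∧
    ∀ (q : ℕ) [NeZero q], 4 < q → Odd q → ∀ χ : DirichletCharacter ℂ q,
      χ.IsPrimitive → χ.IsQuadratic → χ.Odd →
        ∀ (K : Type) [Field K] [NumberField K],
          Module.finrank ℚ K = 2 → NumberField.discr K = -(q : ℤ) →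
            ∀ (ψ : ClassGroup (𝓞 K) →* ℂˣ) (T : ℝ) (S : Finset ℝ) (t' : ℝ → ℝ),
              (q : ℝ) ^ (65 : ℕ) ≤ T → IsDyadicPointSet S T → (∀ t ∈ S, (q : ℝ) ^ (65 : ℕ) + q ≤ t) →
                (∀ t ∈ S, t' t ≠ t ∧ |t' t - t| ≤ 1) →
                defectD K ψ q S t' ≤
                  C * (T * Real.log q ^ (7 : ℕ) + T * calL χ T * Real.log T ^ (4 : ℕ)) := by
  obtain ⟨C₆, hC₆, h6⟩ := hS6
  obtain ⟨C₃, hC₃, hx⟩ := norm_xQuot_le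
  refine ⟨15 * C₆ + 27 * C₃ ^ 2 * C₆, by positivity,
    fun q _ hq hodd χ hprim hquad hoddχ K _ _ h2 hdisc ψ T S t' hT hS hfloor hclose => ?_⟩
  classical
  have hq0 : 0 < q := by omega
  have hq5 : (5 : ℝ) ≤ q := by exact_mod_cast hq
  have hℓ1 : 1 < Real.log q := by
    rw [Real.lt_log_iff_exp_lt (by linarith)]
    exact Real.exp_one_lt_d9.trans_le (by linarith)
  set ℓ : ℝ := Real.log q with hℓdef
  -- `q ≤ q^65 ≤ T`, so `log q ≤ log T`, `2 ≤ T`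
  have hq_le_T : (q : ℝ) ≤ T := le_trans (le_self_pow₀ (by linarith) (by norm_num)) hT
  have hT2 : (2 : ℝ) ≤ T := by linarith
  have hT0 : 0 < T := by linarith
  set LT : ℝ := Real.log T with hLTdef
  have hℓLT : ℓ ≤ LT := Real.log_le_log (by positivity) hq_le_T
  have hLT1 : 1 < LT := lt_of_lt_of_le hℓ1 hℓLT
  have hLT0 : 0 < LT := by linarith
  -- the three mean squares
  obtain ⟨hB, hAN, hr⟩ := h6 q hq hodd χ hprim hquad hoddχ K h2 hdisc ψ T S t' hT hS hfloor hclose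
  -- root number `W = 1`
  have hW : (ψ (differentClass K) : ℂ) = 1 := by
    rw [Literature.NumberTheory.QuadraticFields.Quadratic.differentClass_eq_one_of_finrank_eq_two K h2,
      map_one, Units.val_one]
  -- pointwise bound
  have hpt : ∀ t ∈ S,
      ‖dividedDifference (classGroupLFunction K ψ) (1 / 2 + t * I) (1 / 2 + t' t * I) -
          xQuot q (1 / 2 + t * I) (1 / 2 + t' t * I) *
            starRingEnd ℂ (shortLSum K ψ q (1 / 2 + t * I))‖ ^ 2 ≤
        12 * ‖(afeA K ψ q (1 / 2 + t * I) - afeA K ψ q (1 / 2 + t' t * I)) /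
              ((t : ℂ) * I - t' t * I)‖ ^ 2 +
          3 * ((3 * C₃ * LT) ^ 2 *
              ‖afeA K ψ q (1 / 2 + t * I) - shortLSum K ψ q (1 / 2 + t * I)‖ ^ 2) +
          3 * ‖(afeR K ψ q (1 / 2 + t * I) - afeR K ψ q (1 / 2 + t' t * I)) /
              ((t : ℂ) * I - t' t * I)‖ ^ 2 := by
    intro t ht
    have hTt : T < t := (hS.mem_bounds ht).1
    have ht2T : t ≤ 2 * T := (hS.mem_bounds ht).2
    have ht0 : 0 < t := by linarith
    have ht2 : (2 : ℝ) ≤ t := by linarith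
    have htne : t ≠ 0 := by linarith
    have ht'ne : t' t ≠ 0 := by
      have := (hclose t ht).2
      intro h0; rw [h0, zero_sub, abs_neg, abs_of_pos ht0] at this; linarith
    have hid := pointwise_identity (L := classGroupLFunction K ψ) (A := afeA K ψ q)
      (X := afeX q) (R := afeR K ψ q) (hclose t ht).1 (shortLSum K ψ q (1 / 2 + t * I))
      (by have := classGroupLFunction_eq_afe_all q hq hodd K h2 hdisc ψ t htne; rwa [hW, one_mul] at this)
      (by have := classGroupLFunction_eq_afe_all q hq hodd K h2 hdisc ψ (t' t) ht'ne
          rwa [hW, one_mul] at this)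
    have hX1 : ‖afeX q (1 / 2 + t' t * I)‖ = 1 := norm_afeX_half q hq0 (t' t)
    have hineq :
        ‖dividedDifference (classGroupLFunction K ψ) (1 / 2 + t * I) (1 / 2 + t' t * I) -
            xQuot q (1 / 2 + t * I) (1 / 2 + t' t * I) *
              starRingEnd ℂ (shortLSum K ψ q (1 / 2 + t * I))‖ ^ 2 ≤
          12 * ‖(afeA K ψ q (1 / 2 + t * I) - afeA K ψ q (1 / 2 + t' t * I)) /
                ((t : ℂ) * I - t' t * I)‖ ^ 2 +
            3 * (‖xQuot q (1 / 2 + t * I) (1 / 2 + t' t * I)‖ ^ 2 *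
                ‖starRingEnd ℂ (afeA K ψ q (1 / 2 + t * I) - shortLSum K ψ q (1 / 2 + t * I))‖ ^ 2) +
            3 * ‖(afeR K ψ q (1 / 2 + t * I) - afeR K ψ q (1 / 2 + t' t * I)) /
                ((t : ℂ) * I - t' t * I)‖ ^ 2 :=
      norm_sq_le_three (X' := afeX q (1 / 2 + t' t * I)) hX1 (Complex.norm_conj _)
        (by simpa only [xQuot] using hid)
    rw [Complex.norm_conj] at hineq
    refine hineq.trans ?_
    have hxb : ‖xQuot q (1 / 2 + t * I) (1 / 2 + t' t * I)‖ ≤ 3 * C₃ * LT := by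
      refine (hx q hq t (t' t) ht2).trans ?_
      have hlogt : Real.log t ≤ Real.log (2 * T) := Real.log_le_log ht0 ht2T
      have hlog2T : Real.log (2 * T) ≤ 2 * LT := by
        rw [Real.log_mul (by norm_num) hT0.ne']
        have : Real.log 2 ≤ LT := le_trans (by
          have := Real.log_two_lt_d9; linarith) hLT1.le
        linarith
      nlinarith
    have hx2 : ‖xQuot q (1 / 2 + t * I) (1 / 2 + t' t * I)‖ ^ 2 ≤ (3 * C₃ * LT) ^ 2 :=
      pow_le_pow_left₀ (norm_nonneg _) hxb 2
    gcongr
  -- sum over `S`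
  have hsum : defectD K ψ q S t' ≤
      12 * ∑ t ∈ S, ‖(afeA K ψ q (1 / 2 + t * I) - afeA K ψ q (1 / 2 + t' t * I)) /
              ((t : ℂ) * I - t' t * I)‖ ^ 2 +
        3 * (3 * C₃ * LT) ^ 2 *
          ∑ t ∈ S, ‖afeA K ψ q (1 / 2 + t * I) - shortLSum K ψ q (1 / 2 + t * I)‖ ^ 2 +
        3 * ∑ t ∈ S, ‖(afeR K ψ q (1 / 2 + t * I) - afeR K ψ q (1 / 2 + t' t * I)) /
              ((t : ℂ) * I - t' t * I)‖ ^ 2 := by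
    unfold defectD
    refine (Finset.sum_le_sum hpt).trans (le_of_eq ?_)
    rw [Finset.sum_add_distrib, Finset.sum_add_distrib, ← Finset.mul_sum, ← Finset.mul_sum,
      ← Finset.mul_sum, ← Finset.mul_sum]
    ring
  -- numerics
  set M : ℝ := T * ℓ ^ (7 : ℕ) + T * calL χ T * LT ^ (4 : ℕ) with hMdef
  have hcalL : 0 ≤ calL χ T := calL_nonneg χ (by linarith)
  have hM0 : 0 ≤ M := by positivity
  have hTM : T ≤ M := by
    have h7 : (1 : ℝ) ≤ ℓ ^ (7 : ℕ) := one_le_pow₀ hℓ1.le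
    have : T * 1 ≤ T * ℓ ^ (7 : ℕ) := by gcongr
    have : 0 ≤ T * calL χ T * LT ^ (4 : ℕ) := by positivity
    linarith
  have hAN' : (3 * C₃ * LT) ^ 2 *
      ∑ t ∈ S, ‖afeA K ψ q (1 / 2 + t * I) - shortLSum K ψ q (1 / 2 + t * I)‖ ^ 2 ≤
      9 * C₃ ^ 2 * (C₆ * M) := by
    have : (3 * C₃ * LT) ^ 2 = 9 * C₃ ^ 2 * LT ^ (2 : ℕ) := by ring
    rw [this, mul_assoc]
    exact mul_le_mul_of_nonneg_left hAN (by positivity)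
  have hCT : C₆ * T ≤ C₆ * M := mul_le_mul_of_nonneg_left hTM hC₆.le
  have e2 : 3 * (3 * C₃ * LT) ^ 2 *
      ∑ t ∈ S, ‖afeA K ψ q (1 / 2 + t * I) - shortLSum K ψ q (1 / 2 + t * I)‖ ^ 2 ≤
      27 * C₃ ^ 2 * (C₆ * M) := by
    rw [mul_assoc]; linarith [hAN']
  calc defectD K ψ q S t' ≤ _ := hsum
    _ ≤ 12 * (C₆ * M) + 27 * C₃ ^ 2 * (C₆ * M) + 3 * (C₆ * M) := by linarith [hB, e2, hr, hCT]
    _ = (15 * C₆ + 27 * C₃ ^ 2 * C₆) * M := by ring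

/-- **PROPOSITION 8.1 (8.10) ABOVE THE FLOOR, FROM PROPOSITION 6.4**: for `q` odd `> 4`,
`K = ℚ(√−q)`, `ψ ∈ Ĉℓ(K)`, `1`-spaced `S ⊂ (T, 2T]` with every point `≥ q^65 + q`, `q^65 ≤ T`, and
companions `|t′ − t| ≤ 1` (coincident companions allowed, by the tree's `defectD_limit`):
`D(T) ≤ C(T(log q)^7 + Tℒ(T)(log T)^4)`. [cite: ConreyIwaniec2002, Proposition 8.1 (8.10)] -/
theorem prop81_floor_close_of_proposition64 (h64 : conreyIwaniec2002_proposition64) :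
    ∃ C : ℝ, 0 < C ∧
    ∀ (q : ℕ) [NeZero q], 4 < q → Odd q → ∀ χ : DirichletCharacter ℂ q,
      χ.IsPrimitive → χ.IsQuadratic → χ.Odd →
        ∀ (K : Type) [Field K] [NumberField K],
          Module.finrank ℚ K = 2 → NumberField.discr K = -(q : ℤ) →
            ∀ (ψ : ClassGroup (𝓞 K) →* ℂˣ) (T : ℝ) (S : Finset ℝ) (t' : ℝ → ℝ),
              (q : ℝ) ^ (65 : ℕ) ≤ T → IsDyadicPointSet S T → (∀ t ∈ S, (q : ℝ) ^ (65 : ℕ) + q ≤ t) →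
                (∀ t ∈ S, |t' t - t| ≤ 1) →
                defectD K ψ q S t' ≤
                  C * (T * Real.log q ^ (7 : ℕ) + T * calL χ T * Real.log T ^ (4 : ℕ)) := by
  -- the three mean squares above the floor
  obtain ⟨C₁, hC₁, h₁⟩ := main_meanSquares' h64 divisorSq_weighted_tsum_le
  obtain ⟨C₂, hC₂, h₂⟩ := residual_meanSquare_le'
  have hS6 := defectD_le_of_meanSquares' ⟨max C₁ C₂, lt_max_of_lt_left hC₁,
    fun q _ hq hodd χ hprim hquad hχodd K _ _ h2 hdisc ψ T S t' hT hS hfloor ht' => by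
      obtain ⟨hA, hB⟩ := h₁ q hq hodd χ hprim hquad hχodd K h2 hdisc ψ T S t' hT hS hfloor ht'
      have hR := h₂ q hq K h2 hdisc ψ T S t' hT hS ht'
      obtain ⟨hℓ1, -, hLT1, -, -, -, hT3, -⟩ := prop81_numerics65 hq hT
      have hT0 : 0 ≤ T := by linarith
      have hX : 0 ≤ T * Real.log q ^ (7 : ℕ) + T * calL χ T * Real.log T ^ (4 : ℕ) := by
        have h1 : 0 ≤ Real.log q := by linarith
        have h2 : 0 ≤ Real.log T := by linarith
        have h3 : 0 ≤ calL χ T := calL_nonneg χ (by linarith)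
        positivity
      exact ⟨hA.trans (mul_le_mul_of_nonneg_right (le_max_left _ _) hX),
        hB.trans (mul_le_mul_of_nonneg_right (le_max_left _ _) hX),
        hR.trans (mul_le_mul_of_nonneg_right (le_max_right _ _) hT0)⟩⟩
  obtain ⟨C, hC, h⟩ := hS6
  refine ⟨C, hC, fun q _ hq hodd χ hprim hquad hoddχ K _ _ h2 hdisc ψ T S t' hT hS hfloor hclose => ?_⟩
  have hq0 : 0 < q := by omega
  obtain ⟨-, -, -, -, -, -, hT3, -⟩ := prop81_numerics65 hq hT
  have hSpos : ∀ t ∈ S, 0 < t := fun t ht => by linarith [(hS.mem_bounds ht).1]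
  refine defectD_limit ψ hq0 S hSpos t' fun ε hε hε1 => ?_
  refine h q hq hodd χ hprim hquad hoddχ K h2 hdisc ψ T S _ hT hS hfloor fun t ht => ?_
  by_cases h0 : t' t = t
  · simp only [h0, if_true]
    constructor
    · linarith
    · rw [show t + ε - t = ε by ring, abs_of_pos hε]; exact hε1
  · simp only [h0, if_false]
    exact ⟨h0, hclose t ht⟩

/-! ### Proposition 9.1 above the floor -/

/-- **PROPOSITION 9.1 (9.7) for `1`-spaced `S ⊂ (T,2T] ∩ [q^65 + q, ∞)`, `q^65 ≤ T`, `e^{(log q)²} ≤ T`,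
companions `|t′(t) − t| ≤ 1`, FROM PROPOSITION 8.1 (8.10) above the floor** (Corollary 6.3 in the large range,
Lemma 7.5, the bilinear mean value, the mollifier identity and mean square: all tree theorems).
The tree's `prop91_close_of` verbatim with the floor hypotheses: (8.10) is used only for the given
`(S, t′)`; `(log q)² ≤ log T` enters here (and only here) through `prop91_algebra'`. [cite: ConreyIwaniec2002, Proposition 9.1 (9.7), proof p. 20 L1–44] -/
theorem prop91_floor_close_of
    (h81 : ∃ C : ℝ, 0 < C ∧
      ∀ (q : ℕ) [NeZero q], 4 < q → Odd q → ∀ χ : DirichletCharacter ℂ q,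
        χ.IsPrimitive → χ.IsQuadratic → χ.Odd →
          ∀ (K : Type) [Field K] [NumberField K],
            Module.finrank ℚ K = 2 → NumberField.discr K = -(q : ℤ) →
              ∀ (ψ : ClassGroup (𝓞 K) →* ℂˣ) (T : ℝ) (S : Finset ℝ) (t' : ℝ → ℝ),
                (q : ℝ) ^ (65 : ℕ) ≤ T → IsDyadicPointSet S T → (∀ t ∈ S, (q : ℝ) ^ (65 : ℕ) + q ≤ t) →
                  (∀ t ∈ S, |t' t - t| ≤ 1) →
                  defectD K ψ q S t' ≤
                    C * (T * Real.log q ^ (7 : ℕ) + T * calL χ T * Real.log T ^ (4 : ℕ))) :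
    ∃ C : ℝ, 0 < C ∧
    ∀ (q : ℕ) [NeZero q], 4 < q → Odd q → ∀ χ : DirichletCharacter ℂ q,
      χ.IsPrimitive → χ.IsQuadratic → χ.Odd →
        ∀ (K : Type) [Field K] [NumberField K],
          Module.finrank ℚ K = 2 → NumberField.discr K = -(q : ℤ) →
            ∀ (ψ : ClassGroup (𝓞 K) →* ℂˣ) (T : ℝ) (S : Finset ℝ) (t' : ℝ → ℝ),
              (q : ℝ) ^ (65 : ℕ) ≤ T → Real.exp (Real.log q ^ (2 : ℕ)) ≤ T → IsDyadicPointSet S T →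
                (∀ t ∈ S, (q : ℝ) ^ (65 : ℕ) + q ≤ t) → (∀ t ∈ S, |t' t - t| ≤ 1) →
                defectE K ψ q S t' ≤
                  C * (T * Real.log q ^ (6 : ℕ) +
                    T * Real.sqrt (calL χ T) * Real.log T ^ (2 : ℕ) * Real.log q ^ ((5 : ℝ) / 2)) := by
  obtain ⟨C₁, hC₁, h81⟩ := h81
  obtain ⟨C₅, hC₅, h63⟩ := corollary63_large
  obtain ⟨C₃, hC₃, hx⟩ := norm_xQuot_le
  obtain ⟨C₄, hC₄, hB⟩ := bilinear_hyperbolic_dyadic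
  obtain ⟨C₂, hC₂, hM⟩ := sum_norm_shortInvSum_sq_le
  refine ⟨Real.sqrt (C₁ * C₂) + 15000 * C₃ * C₄ * Real.sqrt C₅, by positivity,
    fun q _ hq hodd χ hprim hquad hoddχ K _ _ h2 hdisc ψ T S t' hT65 hexpT hS hfloor hclose => ?_⟩
  classical
  have hq0 : 0 < q := by omega
  have hqpos : (0 : ℝ) < q := by exact_mod_cast hq0
  obtain ⟨hℓ1, hℓLT, hq4T, hq_le_T, hT0, hℓ_le_LT, hLT1⟩ := range_numerics hq hT65 hexpT
  have hT2 : (2 : ℝ) ≤ T := le_trans (by exact_mod_cast (by omega : 2 ≤ q)) hq_le_T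
  obtain ⟨hL1q, hcLT, hcLq0, hcLq⟩ :=
    calL_numerics hq χ hq_le_T (norm_LFunction_one_ge q hq χ hprim hquad hoddχ K h2 hdisc)
  obtain ⟨hxpt, hXB⟩ := xQuot_segment_le hC₃ hx hq hT2 hS t' hℓ_le_LT hLT1
  obtain ⟨hA₁, hBn₁, hA₂, hBn₂, hrq⟩ :=
    coeff_sums_le' hq K ψ
      (fun hn => idealNormCount_eq_norm_divisorSumChar_of_quadratic hprim hquad hoddχ K h2 hdisc hn)
      hC₅ (h63 q hq χ hprim hquad hoddχ)
  -- Proposition 8.1 AT THIS `(S, t′)` and the mollifier mean square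
  have hD := h81 q hq hodd χ hprim hquad hoddχ K h2 hdisc ψ T S t' hT65 hS hfloor hclose
  have hSM := hM q hq hodd χ hprim hquad hoddχ K h2 hdisc ψ T S hq4T hS
  -- the separated bilinear bounds
  have hNT : ((q ^ 4 : ℕ) : ℝ) ≤ T := by push_cast; exact hq4T
  have hq2 : 2 ≤ q ^ 4 := by
    calc 2 ≤ 2 ^ 4 := by norm_num
      _ ≤ q ^ 4 := Nat.pow_le_pow_left (by omega) 4
  have hlog4 : Real.log ((q ^ 4 : ℕ) : ℝ) = 4 * Real.log q := by
    push_cast; rw [Real.log_pow]; push_cast; ring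
  have hSB₁ := hB (q ^ 4) (q ^ 4) (q ^ 2 + 1) (q ^ 4) 1 (q ^ 4)
    (twistMoebius K (classGroupCharIdealHom ψ)) (twistCount K (classGroupCharIdealHom ψ)) T S
    (Nat.le_add_left 1 _) le_rfl le_rfl le_rfl hq2 hT0 hNT hS
  have hSB₂ := hB (q ^ 4) (q ^ 4) 1 (q ^ 2) (q ^ 2 + 1) (q ^ 4)
    (twistMoebius K (classGroupCharIdealHom ψ)) (twistCount K (classGroupCharIdealHom ψ)) T S
    le_rfl (Nat.pow_le_pow_right hq0 (by norm_num)) (Nat.le_add_left 1 _) le_rfl hq2 hT0 hNT hS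
  rw [hlog4] at hSB₁ hSB₂
  -- `E ≤ √D √(Σ|M|²) + X (Σ|B₁| + Σ|B₂|)`
  have hE := defectE_le_diag_offdiag K ψ q S t' (C₃ * (Real.log q + Real.log (2 * T)))
    (fun t => shortInvSum_mul_shortLSum_sub_one K ψ q hq0 (1 / 2 + t * I)) hxpt
  have hSB₁0 : 0 ≤ ∑ t ∈ S, ‖(∑ m ∈ Finset.Icc (q ^ 2 + 1) (q ^ 4), ∑ n ∈ Finset.Icc 1 (q ^ 4),
            if q ^ 4 < m * n then
              twistMoebius K (classGroupCharIdealHom ψ) m * (m : ℂ) ^ (-(1 / 2 + t * I)) *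
                (twistCount K (classGroupCharIdealHom ψ) n * (n : ℂ) ^ (-(1 / 2 + t * I)))
            else 0)‖ := Finset.sum_nonneg fun _ _ => norm_nonneg _
  have hSB₂0 : 0 ≤ ∑ t ∈ S, ‖(∑ m ∈ Finset.Icc 1 (q ^ 2), ∑ n ∈ Finset.Icc (q ^ 2 + 1) (q ^ 4),
            if q ^ 4 < m * n then
              twistMoebius K (classGroupCharIdealHom ψ) m * (m : ℂ) ^ (-(1 / 2 + t * I)) *
                (twistCount K (classGroupCharIdealHom ψ) n * (n : ℂ) ^ (-(1 / 2 + t * I)))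
            else 0)‖ := Finset.sum_nonneg fun _ _ => norm_nonneg _
  -- assemble
  exact prop91_algebra' hC₁ hC₂ hC₃ hC₄ hC₅ hT0.le hℓ1 hℓLT (norm_nonneg _) hqpos hL1q
    (by positivity) hrq hcLq0 hcLq hcLT hE hD hSM hXB hSB₁0 hSB₂0 hSB₁ hSB₂ hA₁ hBn₁ hA₂ hBn₂

/-- **PROPOSITION 9.1 (9.7) ABOVE THE FLOOR, CLOSE COMPANIONS, FROM PROPOSITION 6.4**: for `q` odd
`> 4`, `K = ℚ(√−q)`, `ψ ∈ Ĉℓ(K)`, `1`-spaced `S ⊂ (T, 2T]` with every point `≥ q^65 + q`,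
`q^65 ≤ T`, `e^{(log q)²} ≤ T`, companions `|t′ − t| ≤ 1`:
`E(T) ≤ C(T(log q)^6 + Tℒ(T)^{1/2}(log T)²(log q)^{5/2})`. [cite: ConreyIwaniec2002, Proposition 9.1 (9.7)] -/
theorem prop91_floor_close_of_proposition64 (h64 : conreyIwaniec2002_proposition64) :
    ∃ C : ℝ, 0 < C ∧
    ∀ (q : ℕ) [NeZero q], 4 < q → Odd q → ∀ χ : DirichletCharacter ℂ q,
      χ.IsPrimitive → χ.IsQuadratic → χ.Odd →
        ∀ (K : Type) [Field K] [NumberField K],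
          Module.finrank ℚ K = 2 → NumberField.discr K = -(q : ℤ) →
            ∀ (ψ : ClassGroup (𝓞 K) →* ℂˣ) (T : ℝ) (S : Finset ℝ) (t' : ℝ → ℝ),
              (q : ℝ) ^ (65 : ℕ) ≤ T → Real.exp (Real.log q ^ (2 : ℕ)) ≤ T → IsDyadicPointSet S T →
                (∀ t ∈ S, (q : ℝ) ^ (65 : ℕ) + q ≤ t) → (∀ t ∈ S, |t' t - t| ≤ 1) →
                defectE K ψ q S t' ≤
                  C * (T * Real.log q ^ (6 : ℕ) +
                    T * Real.sqrt (calL χ T) * Real.log T ^ (2 : ℕ) * Real.log q ^ ((5 : ℝ) / 2)) :=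
  prop91_floor_close_of (prop81_floor_close_of_proposition64 h64)

end ConreyIwaniec2002

end Literature.NumberTheory.LFunctions

end
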